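import Summits.AtomisticToContinuum.Crystallization.Theorems.ChartedZeroExcessLayeredLatticeLiouvilleZZZYRCH

/-!
# Charted zero-excess layered-lattice Liouville — ZZZYRCI: THE CLUSTER PARTITION OF UNITY RESUMS (generic; (PF♯-D) ⟸ MASS-POS, PROVED)

Cell `decomp-a2c`, lens 2, generation 99.  The (PF♯)/(PF♯-D) items of the chain are «support · ATTACKABLE-S · finsum algebra» — up to ONE
geometric input this file isolates: **MASS POSITIVITY** `MassPosP s Λ c₀ ℓ₀ ϱ R` — every in-range pair (`0 < ‖e‖ ≤ ϱ`) of an admissible word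
has positive cluster mass `pairMass R = Σ_c pairWeight R c > 0`, i.e. SOME lattice site lies within `R` of both endpoints.  For `‖e‖ ≤ R` the
endpoint itself is such a centre (generic); for `R < ‖e‖ ≤ ϱ` it needs a site within `R − ‖e‖/2` of the midpoint — the 3-D covering radius of the
clean word (`≤ 0.755`, memo NODE-g99 §2(c) R-1) against `R − ϱ/2 = 1` at the dials of record `(ϱ, R) = (4, 3)`: a CELL-ID-level geometric lemma,
typed here, not proved.  (Without it the weights `w/m` of a massless pair are `0/0 = 0` and its debit would silently drop out of every cluster.)

PROVED here, over an ARBITRARY `c`-co-Lipschitz layered word: the generic resummation `pair_partition_hasSum` — for any pair functional `F`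
supported on the pairs of length `≤ ϱ` touching a finite index set and with non-zero mass on its support,
`HasSum (c ↦ Σᶠ_x (pairWeight R c x / pairMass R x)·F x) (Σᶠ_x F x)` (all sums finite: `finite_nearPairs`, `finite_near_lsite`; Fubini on
Finsets; `Σ_{c} pairWeight = pairMass` on the finite centre set) — and its corollary
`partitionIdentityDebitP_of_massPos : 0 < c₀ → MassPosP s Λ c₀ ℓ₀ ϱ R → PartitionIdentityDebitP s Λ c₀ ℓ₀ ϱ R` ((PF♯-D) of ZZZYRCD, for ALL
tables `θR θN`).  The same lemma with `F :=` the pair part of `clusterFormFull` is the pair half of (PF♯); its plaquette half needs the analogous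
`plaqMass > 0` (plaquette diameter `≤ 2r₁ < R`) — next file.

Def + theorem file (1 def, 4 theorems); imports ZZZYRCH; no instance / notation / option; 0 sorry. [g99]
-/

open scoped BigOperators InnerProductSpace RealInnerProductSpace

namespace Summit.AtomisticToContinuum.Crystallization.Theorems.ChartedZeroExcessLayeredLatticeLiouville

open Summit.AtomisticToContinuum.Crystallization.Theorems.ChartedPlanarOrderRigidityDoor (E3)

/-- **MASS-POS «MassPosP s Λ c₀ ℓ₀ ϱ R»** — every in-range pair of an admissible word has positive cluster mass (some lattice site within `R` of
both endpoints).  support · GEOMETRIC (CELL-ID level: 3-D covering radius of the clean word `≤ R − ϱ/2`) · why it might fail: only if `ϱ > 2(R −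
r_cov)`; at `(4, 3)` the slack is `1 − 0.755`. [g99] -/
def MassPosP (s Λ c₀ ℓ₀ ϱ R : ℝ) : Prop :=
  ∀ a : ℝ, 0 < a → ∀ (L : E3 ≃L[ℝ] E3) (w' : ℤ → E3), IsAdmissibleWord a s Λ c₀ ℓ₀ L w' →
    ∀ x : (Cell 2 × ℤ) × (Cell 2 × ℤ), 0 < ‖bondVec (gen₁ L) (gen₂ L) w' x‖ → ‖bondVec (gen₁ L) (gen₂ L) w' x‖ ≤ ϱ →
      0 < pairMass R (gen₁ L) (gen₂ L) w' x

/-- the centres carrying a pair lie within `R` of its first endpoint. [g99] -/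
theorem pairWeight_eq_zero_of_far {R : ℝ} (a b : E3) (w : ℤ → E3) (c : Cell 2 × ℤ) (x : (Cell 2 × ℤ) × (Cell 2 × ℤ))
    (h : ¬‖lsite a b w c.1 c.2 - lsite a b w x.1.1 x.1.2‖ ≤ R) : pairWeight R a b w c x = 0 := by
  have h' : ¬‖lsite a b w x.1.1 x.1.2 - lsite a b w c.1 c.2‖ ≤ R := by rwa [norm_sub_rev]
  simp only [pairWeight, siteWeight, if_neg h', zero_mul]

/-- ★ **GENERIC RESUMMATION of the cluster partition of unity on pairs**: on a `c`-co-Lipschitz layered word, for every pair functional `F`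
supported on the pairs of length `≤ ϱ` touching the finite index set `S` and with non-zero mass on its support, the cluster shares
`Σᶠ_x (w_c x / m x)·F x` are finitely supported in the centre `c` and sum to `Σᶠ_x F x`. [g99] -/
theorem pair_partition_hasSum {c R ϱ : ℝ} (hc : 0 < c) {a b : E3} {w : ℤ → E3} (hw : IsLayeredCrystal c a b w)
    (S : Finset (Cell 2 × ℤ)) (F : (Cell 2 × ℤ) × (Cell 2 × ℤ) → ℝ)
    (hF : ∀ x, F x ≠ 0 → ‖bondVec a b w x‖ ≤ ϱ ∧ (x.1 ∈ S ∨ x.2 ∈ S)) (hm : ∀ x, F x ≠ 0 → pairMass R a b w x ≠ 0) :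
    HasSum (fun cc : Cell 2 × ℤ => ∑ᶠ x : (Cell 2 × ℤ) × (Cell 2 × ℤ), pairWeight R a b w cc x / pairMass R a b w x * F x)
      (∑ᶠ x : (Cell 2 × ℤ) × (Cell 2 × ℤ), F x) := by
  classical
  -- the finite pair set carrying `F`
  set N := (finite_nearPairs hc hw S ϱ).toFinset with hN_def
  have hFN : ∀ x, F x ≠ 0 → x ∈ N := fun x hx => by
    rw [hN_def, Set.Finite.mem_toFinset]
    exact hF x hx
  have hsuppF : Function.support F ⊆ ↑N := fun x hx => Finset.mem_coe.mpr (hFN x hx)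
  -- the finite centre set carrying the pairs of `N`
  set C : Finset (Cell 2 × ℤ) := N.biUnion fun x => (finite_near_lsite hc hw x.1 R).toFinset with hC_def
  have hwC : ∀ x ∈ N, ∀ cc, pairWeight R a b w cc x ≠ 0 → cc ∈ C := by
    intro x hx cc hcc
    rw [hC_def, Finset.mem_biUnion]
    refine ⟨x, hx, ?_⟩
    rw [Set.Finite.mem_toFinset]
    by_contra h
    exact hcc (pairWeight_eq_zero_of_far a b w cc x h)
  -- each cluster share is a finite sum over `N`
  have hshare : ∀ cc, (∑ᶠ x : (Cell 2 × ℤ) × (Cell 2 × ℤ), pairWeight R a b w cc x / pairMass R a b w x * F x) =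
      ∑ x ∈ N, pairWeight R a b w cc x / pairMass R a b w x * F x := by
    intro cc
    refine finsum_eq_sum_of_support_subset _ fun x hx => ?_
    rw [Function.mem_support] at hx
    refine Finset.mem_coe.mpr (hFN x fun h0 => hx ?_)
    rw [h0, mul_zero]
  -- shares vanish off `C`
  have hoff : ∀ cc ∉ C, (∑ᶠ x : (Cell 2 × ℤ) × (Cell 2 × ℤ), pairWeight R a b w cc x / pairMass R a b w x * F x) = 0 := by
    intro cc hcc
    rw [hshare cc]
    refine Finset.sum_eq_zero fun x hx => ?_
    have hw0 : pairWeight R a b w cc x = 0 := by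
      by_contra h
      exact hcc (hwC x hx cc h)
    rw [hw0, zero_div, zero_mul]
  -- the mass is the finite centre sum
  have hmass : ∀ x ∈ N, ∑ cc ∈ C, pairWeight R a b w cc x = pairMass R a b w x := by
    intro x hx
    unfold pairMass
    rw [finsum_eq_sum_of_support_subset _ fun cc hcc => ?_]
    exact Finset.mem_coe.mpr (hwC x hx cc (Function.mem_support.mp hcc))
  -- assemble
  have hsum : ∑ cc ∈ C, (∑ᶠ x : (Cell 2 × ℤ) × (Cell 2 × ℤ), pairWeight R a b w cc x / pairMass R a b w x * F x) =
      ∑ᶠ x : (Cell 2 × ℤ) × (Cell 2 × ℤ), F x := by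
    rw [finsum_eq_sum_of_support_subset _ hsuppF]
    simp_rw [hshare]
    rw [Finset.sum_comm]
    refine Finset.sum_congr rfl fun x hx => ?_
    have h1 : ∑ cc ∈ C, pairWeight R a b w cc x / pairMass R a b w x * F x =
        (∑ cc ∈ C, pairWeight R a b w cc x) / pairMass R a b w x * F x := by
      rw [Finset.sum_div, Finset.sum_mul]
    rw [h1, hmass x hx]
    by_cases hFx : F x = 0
    · rw [hFx, mul_zero]
    · rw [div_self (hm x hFx), one_mul]
  rw [← hsum]
  exact hasSum_sum_of_ne_finset_zero hoff

/-- the in-range debit of a pair off the support of `φ` vanishes. [g99] -/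
theorem pairDebit_eq_zero_of_notMem {φ : Cell 2 → ℤ → E3} {S : Finset (Cell 2 × ℤ)} (hS : ∀ γ m, (γ, m) ∉ S → φ γ m = 0)
    (θR θN : (Cell 2 × ℤ) × (Cell 2 × ℤ) → ℝ) (a b : E3) (w : ℤ → E3) (x : (Cell 2 × ℤ) × (Cell 2 × ℤ)) (h1 : x.1 ∉ S)
    (h2 : x.2 ∉ S) : pairDebit θR θN a b w φ x = 0 := by
  have hΔ := diff_eq_zero_of_notMem hS x h1 h2
  simp only [pairDebit, sqStretch, hΔ, inner_zero_right, norm_zero]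
  simp

/-- ★★ **(PF♯-D) ⟸ MASS-POS (PROVED)**: on admissible words with positive pair masses in range, the cluster debits resum to the debit form, for
ALL tables `θR θN` — the `hPD` hypothesis of the doors of ZZZYRCD/ZZZYRCE/ZZZYRCG. [g99] -/
theorem partitionIdentityDebitP_of_massPos {s Λ c₀ ℓ₀ ϱ R : ℝ} (hc₀ : 0 < c₀) (hM : MassPosP s Λ c₀ ℓ₀ ϱ R) :
    PartitionIdentityDebitP s Λ c₀ ℓ₀ ϱ R := by
  intro a ha L w' hA φ hφ θR θN
  classical
  obtain ⟨S, hS⟩ := hφ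
  have hw : IsLayeredCrystal c₀ (gen₁ L) (gen₂ L) w' := hA.2.2.2.1
  set F : (Cell 2 × ℤ) × (Cell 2 × ℤ) → ℝ := fun x =>
    if 0 < ‖bondVec (gen₁ L) (gen₂ L) w' x‖ ∧ ‖bondVec (gen₁ L) (gen₂ L) w' x‖ ≤ ϱ then pairDebit θR θN (gen₁ L) (gen₂ L) w' φ x else 0
    with hF_def
  have hF : ∀ x, F x ≠ 0 → ‖bondVec (gen₁ L) (gen₂ L) w' x‖ ≤ ϱ ∧ (x.1 ∈ S ∨ x.2 ∈ S) := by
    intro x hx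
    by_cases h : 0 < ‖bondVec (gen₁ L) (gen₂ L) w' x‖ ∧ ‖bondVec (gen₁ L) (gen₂ L) w' x‖ ≤ ϱ
    · refine ⟨h.2, ?_⟩
      by_contra hor
      apply hx
      simp only [hF_def, if_pos h]
      exact pairDebit_eq_zero_of_notMem hS θR θN _ _ _ x (not_or.mp hor).1 (not_or.mp hor).2
    · exact absurd (by simp only [hF_def, if_neg h]) hx
  have hm : ∀ x, F x ≠ 0 → pairMass R (gen₁ L) (gen₂ L) w' x ≠ 0 := by
    intro x hx
    by_cases h : 0 < ‖bondVec (gen₁ L) (gen₂ L) w' x‖ ∧ ‖bondVec (gen₁ L) (gen₂ L) w' x‖ ≤ ϱ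
    · exact (hM a ha L w' hA x h.1 h.2).ne'
    · exact absurd (by simp only [hF_def, if_neg h]) hx
  exact pair_partition_hasSum hc₀ hw S F hF hm

end Summit.AtomisticToContinuum.Crystallization.Theorems.ChartedZeroExcessLayeredLatticeLiouville
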